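import Mathlib
import HarnessLib
import Literature.MathematicalPhysics.QuantumLattice.FockRelabel
import Literature.MathematicalPhysics.QuantumLattice.HubbardRingPerronFrobeniusProofs
import Literature.MathematicalPhysics.QuantumLattice.FinDimSpectrumSectorGibbsLimit

/-!
# Route `WeakCouplingBCS`, support item `WcbcsTowerTrialBudget` (stmt-HubbardSuperconductivity-1211):
# the Slater-type bound `E^{sec}_U(N) ≤ E^{sec,free}(N) + U N²/(4L²)` by averaging

Support file (`--supports stmt-HubbardSuperconductivity-1211`). For the Hubbard Hamiltonian
`H(t, U)` on the torus `(ℤ/Lℤ)^d` with `U ≥ 0`, the lowest energy in the joint sector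
`(N, S^z) = (2n, 0)` obeys `E^{sec}_U ≤ E^{sec}_0 + U n²/L^d` (`minEnergyOn_szSector_le_free_add`;
on `(ℤ/Lℤ)²` and in terms of `N`: `minEnergyOn_szSector_hubbardTorus_two_le`). This is the
"Slater upper bound" of the item's informal proof, but it is proved WITHOUT plane waves or Slater
determinants, by an averaging argument:

* the orbital permutation `(x, ↑) ↦ (x + a, ↑)`, `(x, ↓) ↦ (x, ↓)` (translate only the up spins) is
  implemented on Fock space by the tree's `fockRelabel` (`FockRelabel.lean`); it fixes the FREE
  hopping Hamiltonian (a sum over the spin label of spinless hoppings, each translation invariant —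
  `relabel_hamiltonian_zero`), `N`, `S^z` and hence the sectors (`fockRelabel_mulVec_mem_szSector`);
* conjugating the on-site repulsion gives `Σ_x n_{x-a,↑} n_{x,↓}`, whose SUM over `a` is `N↑ N↓`
  (`sum_relabel_symm_interaction`), equal to `n²` on the sector; so some translate `U_a Ψ` of a free
  sector ground state `Ψ` has `⟨Σ_x n_{x↑}n_{x↓}⟩ ≤ n²/L^d` (`exists_upShift_interaction_le`), and the
  variational principle in the sector concludes.

The spin-dependent relabelling is handled abstractly (any `e : Orb Λ ≃ Orb Λ` acting as
`(x, σ) ↦ (f_σ x, σ)`), the torus instance being the explicit `Equiv.prodCongrLeft` term; no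
definition is introduced. Sources: E. H. Lieb, PRL 62 (1989) 1201 (sectors); standard.
-/

-- the summit-side namespace `Summit.HubbardSuperconductivity.HubbardSuperconductivity` repeats a
-- component by design (D-0017 nested layout), which the `dupNamespace` linter would flag:
set_option linter.dupNamespace false

namespace Summit.HubbardSuperconductivity.HubbardSuperconductivity.Theorems

open Literature.MathematicalPhysics.QuantumLattice Literature.Probability.LatticeModels Matrix
open scoped ComplexOrder

namespace WcbcsSlater

/-! ### Spin-dependent site relabellings `(x, σ) ↦ (f_σ x, σ)` -/

section SpinDependent

variable {Λ : Type*} [LinearOrder Λ] [Fintype Λ]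
variable (e : Orb Λ ≃ Orb Λ) (f : Fin 2 → Λ ≃ Λ) (he : ∀ (x : Λ) (σ : Fin 2), e (orb x σ) = orb (f σ x) σ)
include he

/-- A spin-dependent site relabelling is covariant on number operators:
`Γ n_{xσ} Γ⁻¹ = n_{f_σ x, σ}`. [folklore] -/
theorem relabel_numberOp (x : Λ) (σ : Fin 2) : relabel e (numberOp x σ) = numberOp (f σ x) σ := by
  rw [numberOp, numberOp, relabel_mul, relabel_creation, relabel_annihilation, he]

/-- The spin-resolved particle numbers `N_σ = Σ_x n_{xσ}` are invariant. [folklore] -/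
theorem relabel_sum_numberOp (σ : Fin 2) :
    relabel e (∑ x : Λ, numberOp x σ) = ∑ x : Λ, numberOp x σ := by
  rw [relabel_sum]
  simp_rw [relabel_numberOp e f he]
  exact (f σ).sum_comp (fun x' => numberOp x' σ)

/-- The total particle number is invariant. [folklore] -/
theorem relabel_totalNumber :
    relabel e (totalNumber : Matrix (Finset (Orb Λ)) (Finset (Orb Λ)) ℂ) = totalNumber := by
  have h : (totalNumber : Matrix (Finset (Orb Λ)) (Finset (Orb Λ)) ℂ) =
      ∑ σ : Fin 2, ∑ x : Λ, numberOp x σ := by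
    rw [totalNumber, Finset.sum_comm]
  rw [h, relabel_sum]
  simp_rw [relabel_sum_numberOp e f he]

/-- `S^z` is invariant. [folklore] -/
theorem relabel_spinZ :
    relabel e (HubbardWave0.spinZ : Matrix (Finset (Orb Λ)) (Finset (Orb Λ)) ℂ) = HubbardWave0.spinZ := by
  have h : (HubbardWave0.spinZ : Matrix (Finset (Orb Λ)) (Finset (Orb Λ)) ℂ) =
      (1 / 2 : ℂ) • ((∑ x : Λ, numberOp x 0) - ∑ x : Λ, numberOp x 1) := by
    rw [HubbardWave0.spinZ, Finset.sum_sub_distrib]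
  rw [h, relabel_smul, relabel_sub, relabel_sum_numberOp e f he, relabel_sum_numberOp e f he]

/-- `U_e` preserves the joint `(N, S^z)` sectors. [folklore] -/
theorem fockRelabel_mulVec_mem_szSector {N : ℕ} {M : ℝ} {ψ : Fock (Orb Λ)} (hψ : ψ ∈ szSector N M) :
    (fockRelabel e).val *ᵥ ψ ∈ szSector N M := by
  rw [mem_szSector_iff] at hψ ⊢
  refine ⟨hψ.1.fockRelabel_mulVec _, ?_⟩
  rw [mulVec_mulVec, ← (fockRelabel_commute_of_relabel_eq _ (relabel_spinZ e f he)).eq, ← mulVec_mulVec,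
    hψ.2, mulVec_smul]

variable (G : SimpleGraph Λ) [DecidableRel G.Adj]

/-- **The free hopping Hamiltonian is invariant under spin-dependent graph automorphisms**: if every
`f_σ` preserves adjacency then `Γ H(t, 0) Γ⁻¹ = H(t, 0)` (the hopping term is a sum over the spin
label of identical spinless hoppings). [folklore] -/
theorem relabel_hamiltonian_zero (hG : ∀ σ x y, G.Adj (f σ x) (f σ y) ↔ G.Adj x y) (t : ℝ) :
    relabel e (hamiltonian G t 0) = hamiltonian G t 0 := by
  -- the spin-`σ` hopping term between `x` and `y`
  set F : Fin 2 → Λ → Λ → Matrix (Finset (Orb Λ)) (Finset (Orb Λ)) ℂ :=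
    fun σ x y => if G.Adj x y then creation (orb x σ) * annihilation (orb y σ) else 0 with hF
  have h0 : hamiltonian G t 0 = -(t : ℂ) • ∑ σ : Fin 2, ∑ x : Λ, ∑ y : Λ, F σ x y := by
    rw [hamiltonian, Complex.ofReal_zero, zero_smul, add_zero]
    congr 1
    calc (∑ x : Λ, ∑ y : Λ, ∑ σ : Fin 2,
          (if G.Adj x y then creation (orb x σ) * annihilation (orb y σ) else 0 :
            Matrix (Finset (Orb Λ)) (Finset (Orb Λ)) ℂ))
        = ∑ x : Λ, ∑ σ : Fin 2, ∑ y : Λ, F σ x y :=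
          Finset.sum_congr rfl fun x _ => Finset.sum_comm
      _ = ∑ σ : Fin 2, ∑ x : Λ, ∑ y : Λ, F σ x y := Finset.sum_comm
  have hterm : ∀ σ x y, relabel e (F σ x y) = F σ (f σ x) (f σ y) := by
    intro σ x y
    simp only [hF]
    by_cases hadj : G.Adj x y
    · rw [if_pos hadj, if_pos ((hG σ x y).2 hadj), relabel_mul, relabel_creation, relabel_annihilation,
        he, he]
    · rw [if_neg hadj, if_neg (fun h => hadj ((hG σ x y).1 h)), map_zero]
  rw [h0, relabel_smul, relabel_sum]
  congr 1
  refine Finset.sum_congr rfl fun σ _ => ?_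
  rw [relabel_sum]
  simp_rw [relabel_sum, hterm]
  calc ∑ x : Λ, ∑ y : Λ, F σ (f σ x) (f σ y) = ∑ x : Λ, ∑ y' : Λ, F σ (f σ x) y' :=
        Finset.sum_congr rfl fun x _ => (f σ).sum_comp (fun y' => F σ (f σ x) y')
    _ = ∑ x' : Λ, ∑ y' : Λ, F σ x' y' := (f σ).sum_comp (fun x' => ∑ y' : Λ, F σ x' y')

omit [LinearOrder Λ] [Fintype Λ] in
/-- The inverse relabelling: `e⁻¹ (x, σ) = (f_σ⁻¹ x, σ)`. [folklore] -/
theorem symm_orb (x : Λ) (σ : Fin 2) : e.symm (orb x σ) = orb ((f σ).symm x) σ := by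
  rw [Equiv.symm_apply_eq, he, Equiv.apply_symm_apply]

/-- The on-site interaction transforms as `Γ⁻¹ (n_{x↑} n_{x↓}) Γ = n_{f₀⁻¹ x, ↑} n_{f₁⁻¹ x, ↓}`. [folklore] -/
theorem relabel_symm_numberOp_mul_numberOp (x : Λ) :
    relabel e.symm (numberOp x 0 * numberOp x 1) = numberOp ((f 0).symm x) 0 * numberOp ((f 1).symm x) 1 := by
  rw [relabel_mul, relabel_numberOp e.symm (fun σ => (f σ).symm) (symm_orb e f he),
    relabel_numberOp e.symm (fun σ => (f σ).symm) (symm_orb e f he)]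

end SpinDependent


/-! ### Expectation bookkeeping -/

section Expect

variable {Λ : Type*} [LinearOrder Λ] [Fintype Λ]

omit [LinearOrder Λ] in
/-- `expect` is additive over finite sums of operators. [folklore] -/
theorem expect_sum {κ : Type*} (s : Finset κ) (A : κ → Matrix (Finset (Orb Λ)) (Finset (Orb Λ)) ℂ)
    (ψ : Fock (Orb Λ)) : expect (∑ k ∈ s, A k) ψ = ∑ k ∈ s, expect (A k) ψ := by
  simp only [expect, Matrix.sum_mulVec, dotProduct_sum]

/-- On the sector with `n` up and `n` down electrons, `N↑ N↓ = n²`. [folklore] -/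
theorem upNumber_mul_downNumber_mulVec {n : ℕ} {ψ : Fock (Orb Λ)} (hψ : IsInSector n n ψ) :
    ((∑ x : Λ, numberOp x 0) * ∑ x : Λ, numberOp x 1) *ᵥ ψ = ((n : ℂ) * n) • ψ := by
  funext s
  rw [← mulVec_mulVec]
  have h1 : ∀ (σ : Fin 2) (φ : Fock (Orb Λ)) (s : Finset (Orb Λ)),
      ((∑ x : Λ, numberOp x σ) *ᵥ φ) s = ((Finset.univ.filter fun x : Λ => orb x σ ∈ s).card : ℂ) * φ s := by
    intro σ φ s
    rw [Matrix.sum_mulVec, Finset.sum_apply]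
    simp_rw [LiebThm1.numberOp_eq_diagonal, mulVec_diagonal]
    rw [← Finset.sum_mul, Finset.sum_boole]
  rw [h1, h1, Pi.smul_apply, smul_eq_mul]
  by_cases hs : (upPart s).card = n ∧ (downPart s).card = n
  · rw [← upPart, ← downPart, hs.1, hs.2]
    ring
  · rw [hψ s hs, mul_zero, mul_zero, mul_zero]

end Expect

/-! ### Spin-up translations on the torus and the averaging argument -/

section Torus

variable {d L : ℕ} [NeZero L]

/-- Translating only the up-spin orbitals by `a`: the site maps `(T_a, id)`. [folklore] -/
theorem upShift_adj (a : TorusSite d L) (σ : Fin 2) (x y : FermionTorus d L) :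
    (fermionTorusGraph d L).Adj
        ((![FermionTorus.ofTorusEquiv (Equiv.addRight a), Equiv.refl _] :
          Fin 2 → FermionTorus d L ≃ FermionTorus d L) σ x)
        ((![FermionTorus.ofTorusEquiv (Equiv.addRight a), Equiv.refl _] :
          Fin 2 → FermionTorus d L ≃ FermionTorus d L) σ y) ↔
      (fermionTorusGraph d L).Adj x y := by
  fin_cases σ
  · exact fermionTorusGraph_adj_addRight a x y
  · rfl

/-- The orbital permutation `(x, ↑) ↦ (x + a, ↑)`, `(x, ↓) ↦ (x, ↓)` acts as stated on orbitals. [folklore] -/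
theorem upShift_orb (a : TorusSite d L) (x : FermionTorus d L) (σ : Fin 2) :
    ((ofLex : Lex (FermionTorus d L × Fin 2) ≃ FermionTorus d L × Fin 2).trans
        ((Equiv.prodCongrLeft fun σ =>
          (![FermionTorus.ofTorusEquiv (Equiv.addRight a), Equiv.refl _] :
            Fin 2 → FermionTorus d L ≃ FermionTorus d L) σ).trans toLex)) (orb x σ) =
      orb ((![FermionTorus.ofTorusEquiv (Equiv.addRight a), Equiv.refl _] :
            Fin 2 → FermionTorus d L ≃ FermionTorus d L) σ x) σ := rfl

/-- `T_a⁻¹ x = x - a` on the fermionic torus. [folklore] -/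
theorem ofTorusEquiv_addRight_symm_apply (a : TorusSite d L) (x : FermionTorus d L) :
    (FermionTorus.ofTorusEquiv (Equiv.addRight a)).symm x =
      FermionTorus.ofTorusSite (FermionTorus.toTorusSite x - a) := by
  simp [FermionTorus.ofTorusEquiv, FermionTorus.equivTorusSite, sub_eq_add_neg]

/-- **Averaging the shifted interaction over all up-spin translations gives `N↑ N↓`**:
`Σ_a Γ_a⁻¹ (Σ_x n_{x↑} n_{x↓}) Γ_a = Σ_x (Σ_a n_{x-a,↑}) n_{x↓} = N↑ N↓`. [folklore] -/
theorem sum_relabel_symm_interaction :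
    ∑ a : TorusSite d L, relabel
        ((ofLex : Lex (FermionTorus d L × Fin 2) ≃ FermionTorus d L × Fin 2).trans
          ((Equiv.prodCongrLeft fun σ =>
            (![FermionTorus.ofTorusEquiv (Equiv.addRight a), Equiv.refl _] :
              Fin 2 → FermionTorus d L ≃ FermionTorus d L) σ).trans toLex)).symm
        (∑ x : FermionTorus d L, numberOp x 0 * numberOp x 1) =
      (∑ x : FermionTorus d L, numberOp x 0) * ∑ x : FermionTorus d L, numberOp x 1 := by
  have hx : ∀ (a : TorusSite d L) (x : FermionTorus d L), relabel
      ((ofLex : Lex (FermionTorus d L × Fin 2) ≃ FermionTorus d L × Fin 2).trans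
        ((Equiv.prodCongrLeft fun σ =>
          (![FermionTorus.ofTorusEquiv (Equiv.addRight a), Equiv.refl _] :
            Fin 2 → FermionTorus d L ≃ FermionTorus d L) σ).trans toLex)).symm
      (numberOp x 0 * numberOp x 1) =
      numberOp (FermionTorus.ofTorusSite (FermionTorus.toTorusSite x - a)) 0 * numberOp x 1 := by
    intro a x
    rw [relabel_symm_numberOp_mul_numberOp _ _ (upShift_orb a)]
    simp only [Matrix.cons_val_zero, Matrix.cons_val_one, ofTorusEquiv_addRight_symm_apply]
    rfl
  simp_rw [relabel_sum, hx]
  rw [Finset.sum_comm, Finset.mul_sum]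
  refine Finset.sum_congr rfl fun x _ => ?_
  rw [Finset.sum_mul]
  exact ((Equiv.subLeft (FermionTorus.toTorusSite x)).trans FermionTorus.equivTorusSite.symm).sum_comp
    (fun y => numberOp y 0 * numberOp x 1)

/-- **Averaging over up-spin translations.** For a unit vector `ψ` with `n` up and `n` down
electrons on the torus `(ℤ/Lℤ)^d` there is an up-spin translation `a` such that the translated
state `U_a ψ` has on-site interaction energy `⟨Σ_x n_{x↑} n_{x↓}⟩ ≤ n² / L^d` (the average over `a`
is exactly `⟨N↑ N↓⟩ / L^d = n² / L^d`). [folklore] -/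
theorem exists_upShift_interaction_le {n : ℕ} {ψ : Fock (Orb (FermionTorus d L))}
    (hψ : IsInSector n n ψ) (hψ1 : star ψ ⬝ᵥ ψ = 1) :
    ∃ a : TorusSite d L, (expect (∑ x : FermionTorus d L, numberOp x 0 * numberOp x 1)
        ((fockRelabel ((ofLex : Lex (FermionTorus d L × Fin 2) ≃ FermionTorus d L × Fin 2).trans
          ((Equiv.prodCongrLeft fun σ =>
            (![FermionTorus.ofTorusEquiv (Equiv.addRight a), Equiv.refl _] :
              Fin 2 → FermionTorus d L ≃ FermionTorus d L) σ).trans toLex))).val *ᵥ ψ)).re ≤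
      (n : ℝ) ^ 2 / Fintype.card (TorusSite d L) := by
  set W : Matrix (Finset (Orb (FermionTorus d L))) (Finset (Orb (FermionTorus d L))) ℂ :=
    ∑ x : FermionTorus d L, numberOp x 0 * numberOp x 1 with hW
  set val : TorusSite d L → ℝ := fun a => (expect W
        ((fockRelabel ((ofLex : Lex (FermionTorus d L × Fin 2) ≃ FermionTorus d L × Fin 2).trans
          ((Equiv.prodCongrLeft fun σ =>
            (![FermionTorus.ofTorusEquiv (Equiv.addRight a), Equiv.refl _] :
              Fin 2 → FermionTorus d L ≃ FermionTorus d L) σ).trans toLex))).val *ᵥ ψ)).re with hval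
  have hsum : ∑ a, val a = (n : ℝ) ^ 2 := by
    simp only [hval]
    simp_rw [expect_fockRelabel_mulVec]
    rw [← Complex.re_sum, ← expect_sum, hW, sum_relabel_symm_interaction, expect,
      upNumber_mul_downNumber_mulVec hψ, dotProduct_smul, hψ1, smul_eq_mul, mul_one]
    norm_cast
    ring
  have hcard : (0 : ℝ) < Fintype.card (TorusSite d L) := by
    exact_mod_cast Fintype.card_pos
  obtain ⟨a, -, ha⟩ := Finset.exists_le_of_sum_le (s := Finset.univ) Finset.univ_nonempty
    (f := val) (g := fun _ => (n : ℝ) ^ 2 / Fintype.card (TorusSite d L)) (by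
      rw [hsum, Finset.sum_const, Finset.card_univ, nsmul_eq_mul]
      field_simp
      exact le_rfl)
  exact ⟨a, ha⟩

/-- **Slater-type upper bound by averaging.** On the torus `(ℤ/Lℤ)^d`, for `U ≥ 0` and the sector
`(N, S^z) = (2n, 0)` with `n ≤ L^d`: `E^{sec}_U(2n) ≤ E^{sec,free}(2n) + U n² / L^d` — take a free
sector ground state, translate its up-spin component so that `⟨Σ_x n_{x↑}n_{x↓}⟩ ≤ n²/L^d`
(`exists_upShift_interaction_le`; the free Hamiltonian and the sector are invariant), and use the
variational principle. No plane waves or Slater determinants are needed. [folklore] -/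
theorem minEnergyOn_szSector_le_free_add (t : ℝ) {U : ℝ} (hU : 0 ≤ U) {n : ℕ}
    (hn : n ≤ Fintype.card (FermionTorus d L)) :
    (hubbardTorus d L t U).minEnergyOn (szSector (2 * n) 0) ≤
      (hubbardTorus d L t 0).minEnergyOn (szSector (2 * n) 0) +
        U * ((n : ℝ) ^ 2 / Fintype.card (TorusSite d L)) := by
  -- a normalised free ground state in the sector
  obtain ⟨⟨ψ₀, hmem, hne, heig⟩, -⟩ := szSector_groundState (fermionTorusGraph d L) t 0 hn
  obtain ⟨c, _, hc1⟩ := exists_smul_unit hne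
  set Ψ := c • ψ₀ with hΨ
  have hΨmem : Ψ ∈ szSector (2 * n) 0 := Submodule.smul_mem _ c hmem
  have hΨsec : IsInSector n n Ψ := (mem_szSector_two_mul_zero_iff n Ψ).1 hΨmem
  have hΨeig : hubbardTorus d L t 0 *ᵥ Ψ =
      (((hubbardTorus d L t 0).minEnergyOn (szSector (2 * n) 0) : ℝ) : ℂ) • Ψ := by
    rw [hΨ, mulVec_smul, hubbardTorus, heig, smul_comm]
  obtain ⟨a, ha⟩ := exists_upShift_interaction_le hΨsec hc1
  -- the translated trial state
  set e := (ofLex : Lex (FermionTorus d L × Fin 2) ≃ FermionTorus d L × Fin 2).trans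
    ((Equiv.prodCongrLeft fun σ =>
      (![FermionTorus.ofTorusEquiv (Equiv.addRight a), Equiv.refl _] :
        Fin 2 → FermionTorus d L ≃ FermionTorus d L) σ).trans toLex) with he_def
  have he := upShift_orb (d := d) (L := L) a
  set Φ := (fockRelabel e).val *ᵥ Ψ with hΦ
  have hΦmem : Φ ∈ szSector (2 * n) 0 := fockRelabel_mulVec_mem_szSector e _ he hΨmem
  have hΦ1 : star Φ ⬝ᵥ Φ = 1 := by rw [hΦ, star_fockRelabel_mulVec_dotProduct, hc1]
  have hH0 : relabel e.symm (hubbardTorus d L t 0) = hubbardTorus d L t 0 := by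
    have h1 := relabel_hamiltonian_zero e _ he (fermionTorusGraph d L) (upShift_adj a) t
    have h2 := congrArg (relabel e.symm) h1
    rwa [relabel_symm_relabel, eq_comm] at h2
  have hsplit : hubbardTorus d L t U = hubbardTorus d L t 0 +
      (U : ℂ) • ∑ x : FermionTorus d L, numberOp x 0 * numberOp x 1 := by
    rw [hubbardTorus, hubbardTorus, hamiltonian, hamiltonian, Complex.ofReal_zero, zero_smul, add_zero]
  -- variational principle
  have hvar := minEnergyOn_le_rayleigh_of_mem (LiebThm1.hamiltonian_isHermitian (fermionTorusGraph d L) t U)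
    (szSector (2 * n) 0) hΦmem hΦ1
  have hray : (star Φ ⬝ᵥ hubbardTorus d L t U *ᵥ Φ).re =
      (hubbardTorus d L t 0).minEnergyOn (szSector (2 * n) 0) +
        U * (expect (∑ x : FermionTorus d L, numberOp x 0 * numberOp x 1) Φ).re := by
    rw [hsplit, add_mulVec, smul_mulVec, dotProduct_add, dotProduct_smul, smul_eq_mul, Complex.add_re,
      Complex.re_ofReal_mul, expect]
    congr 1
    change (expect (hubbardTorus d L t 0) ((fockRelabel e).val *ᵥ Ψ)).re = _
    rw [expect_fockRelabel_mulVec, hH0, expect, hΨeig, dotProduct_smul, hc1, smul_eq_mul, mul_one,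
      Complex.ofReal_re]
  change (hamiltonian (fermionTorusGraph d L) t U).minEnergyOn _ ≤ _ at hvar
  rw [← hubbardTorus, hray] at hvar
  exact hvar.trans (add_le_add le_rfl (mul_le_mul_of_nonneg_left ha hU))

end Torus

/-! ### The bound in the form used by `WcbcsTowerTrialBudget` -/

section General

variable {Λ : Type*} [LinearOrder Λ] [Fintype Λ]

/-- A nonzero vector of the joint sector `(N, S^z = 0)` has `N = 2n` with `n ≤ |Λ|` (`n` = number of
up = number of down electrons of any configuration in its support). [folklore] -/
theorem exists_eq_two_mul_of_mem_szSector_zero {N : ℕ} {ψ : Fock (Orb Λ)} (hψ : ψ ∈ szSector N 0)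
    (h0 : ψ ≠ 0) : ∃ n : ℕ, N = 2 * n ∧ n ≤ Fintype.card Λ := by
  obtain ⟨s, hs⟩ := Function.ne_iff.1 h0
  rw [mem_szSector_iff] at hψ
  have hcard : s.card = N := by
    by_contra hne
    exact hs (hψ.1 s hne)
  have hz := congrFun hψ.2 s
  rw [LiebThm1.spinZ_mulVec_apply, Pi.smul_apply, smul_eq_mul, Complex.ofReal_zero, zero_mul,
    mul_eq_zero, mul_eq_zero] at hz
  rcases hz with (h | h) | h
  · norm_num at h
  · have h' : ((upPart s).card : ℂ) = (downPart s).card := sub_eq_zero.1 h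
    have h'' : (upPart s).card = (downPart s).card := by exact_mod_cast h'
    refine ⟨(upPart s).card, ?_, Finset.card_le_univ _⟩
    rw [← hcard, card_eq_upPart_add_downPart, ← h'', two_mul]
  · exact absurd h hs

end General

/-- **The Slater-type bound on the two-dimensional torus, sector form.** For `U ≥ 0` and a
non-empty sector `(N, S^z = 0)` of `Fock (Orb (FermionTorus 2 L))`:
`E^{sec}_{H(t,U)}(N) ≤ E^{sec}_{H(t,0)}(N) + U N² / (4 L²)`. [folklore] -/
theorem minEnergyOn_szSector_hubbardTorus_two_le (L : ℕ) [NeZero L] (t : ℝ) {U : ℝ} (hU : 0 ≤ U)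
    {N : ℕ} {Φ : Fock (Orb (FermionTorus 2 L))} (hΦ : Φ ∈ szSector N 0) (hΦ0 : Φ ≠ 0) :
    (hubbardTorus 2 L t U).minEnergyOn (szSector N 0) ≤
      (hubbardTorus 2 L t 0).minEnergyOn (szSector N 0) + U * (N : ℝ) ^ 2 / (4 * (L : ℝ) ^ 2) := by
  obtain ⟨n, rfl, hn⟩ := exists_eq_two_mul_of_mem_szSector_zero hΦ hΦ0
  have h := minEnergyOn_szSector_le_free_add (d := 2) (L := L) t hU hn
  have hcard : (Fintype.card (TorusSite 2 L) : ℝ) = (L : ℝ) ^ 2 := by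
    rw [show Fintype.card (TorusSite 2 L) = L ^ 2 by simp [TorusSite, ZMod.card]]
    push_cast
    rfl
  have hL : (L : ℝ) ≠ 0 := by exact_mod_cast NeZero.ne L
  rw [hcard] at h
  convert h using 2
  push_cast
  field_simp
  ring


end WcbcsSlater

end Summit.HubbardSuperconductivity.HubbardSuperconductivity.Theorems
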